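import Mathlib
import HarnessLib
import Summits.AtomisticToContinuum.Crystallization.Theorems.PricedLinkCensusSoftFourRingsCapHexagon1
import Summits.AtomisticToContinuum.Crystallization.Theorems.PricedLinkCensusSoftFourRingsHexagon2

/-!
# Soft four-rings, endgame: no alternating 4-cycle of type-A vertices

Support file for `SoftFourRings` (route `PricedLinkCensus`, sub-problem `Crystallization`),
endgame step (E3)/(E4) of the evidence file (§12.8), point-level form.

* `saturated_eight_false` — eight distinct points of `X` whose bonds all end in a set `T` of at
  most ten points cannot exist (a point outside `T` would have its four bonds among the at most
  three remaining points);
* `alternating_four_cycle_false` — **the `γ`-partner `e` of the `α`-partner `b` is not the `α`-partner `b₃`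
  of the `γ`-partner `d`** (no alternating 4-cycle `v – b – e – d`).

**`Cap` variant** (seat c3 of stmt-AtomisticToContinuum-14234): identical to `PricedLinkCensusSoftFourRingsHexagon2`, except that the
global Tammes-13 hypothesis `(hT : musinTarasov2012_tammes_thirteen)` is replaced by the LOCAL covering
property of the twelve directions, `hT : ∀ p, ‖p‖ = 1 → ∃ x ∈ X, dist p x < 0.957` (no empty cap of
angular radius `57.18°`), which is all the two roots (`FacetCap`, `Interior`) ever used; the hT-free
lemmas are not repeated (the original file is imported for them).
-/

namespace Summit.AtomisticToContinuum.Crystallization.Theorems.Cap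

open Real RealInnerProductSpace Literature.Geometry.DiscreteGeometry

section Setting

open scoped Classical in
/-- The core of the 4-cycle exclusion: with the 4-cycle `v – b – e – d` in place (`d` the
`α`-partner of `e`, wings `p₁, p₂` of `{d, e}` with `a ∼ p₁`, `c ∼ p₂`), the eight points
`v, b, d, e, a, c, p₁, p₂` are saturated by at most ten points. -/
theorem four_cycle_core
    {X : Finset (EuclideanSpace ℝ (Fin 3))}
    {B : Finset (Finset (EuclideanSpace ℝ (Fin 3)))}
    (hT : ∀ p : EuclideanSpace ℝ (Fin 3), ‖p‖ = 1 → ∃ x ∈ X, dist p x < 0.957)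
    (hX1 : ∀ y ∈ X, ‖y‖ = 1)
    (hcard : X.card = 12)
    (hsepX : ∀ u ∈ X, ∀ u' ∈ X, u ≠ u' → ⟪u, u'⟫ ≤ 1 - 1 / (2 * (101 / 100 : ℝ) ^ 2))
    (hB : ∀ T ∈ B, ∃ u ∈ X, ∃ u' ∈ X, u ≠ u' ∧ 1 - (101 / 100 : ℝ) ^ 2 / 2 ≤ ⟪u, u'⟫ ∧ T = {u, u'})
    (hBcard : B.card = 24)
    (hdeg : ∀ v ∈ X, ∃ w : Fin 4 → EuclideanSpace ℝ (Fin 3), (∀ k, w k ∈ X) ∧ Function.Injective w ∧ (∀ k, w k ≠ v) ∧ (∀ k, ({v, w k} : Finset (EuclideanSpace ℝ (Fin 3))) ∈ B) ∧ ∀ y, ({v, y} : Finset (EuclideanSpace ℝ (Fin 3))) ∈ B → ∃ k, y = w k) {v a b c d e p₁ p₂ x₁ y₁ x₂ y₂ q₁ q₂ : EuclideanSpace ℝ (Fin 3)} (hv : v ∈ X)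
    (hN : ∀ y, ({v, y} : Finset (EuclideanSpace ℝ (Fin 3))) ∈ B ↔ (y = a ∨ y = b ∨ y = c ∨ y = d))
    (hd : a ≠ b ∧ a ≠ c ∧ a ≠ d ∧ b ≠ c ∧ b ≠ d ∧ c ≠ d)
    (hab : ({a, b} : Finset (EuclideanSpace ℝ (Fin 3))) ∈ B) (hbc : ({b, c} : Finset (EuclideanSpace ℝ (Fin 3))) ∈ B)
    (hac : ({a, c} : Finset (EuclideanSpace ℝ (Fin 3))) ∉ B) (had : ({a, d} : Finset (EuclideanSpace ℝ (Fin 3))) ∉ B)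
    (hbd : ({b, d} : Finset (EuclideanSpace ℝ (Fin 3))) ∉ B) (hcd : ({c, d} : Finset (EuclideanSpace ℝ (Fin 3))) ∉ B)
    (he : e ≠ v ∧ e ≠ a ∧ e ≠ b ∧ e ≠ c ∧ e ≠ d)
    (hNb : ∀ y, ({b, y} : Finset (EuclideanSpace ℝ (Fin 3))) ∈ B ↔ (y = a ∨ y = v ∨ y = c ∨ y = e))
    (hae : ({a, e} : Finset (EuclideanSpace ℝ (Fin 3))) ∉ B) (hce : ({c, e} : Finset (EuclideanSpace ℝ (Fin 3))) ∉ B)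
    (hNd : ∀ y, ({d, y} : Finset (EuclideanSpace ℝ (Fin 3))) ∈ B ↔ (y = p₁ ∨ y = e ∨ y = p₂ ∨ y = v))
    (hp : p₁ ≠ e ∧ p₁ ≠ p₂ ∧ p₁ ≠ v ∧ e ≠ p₂ ∧ p₂ ≠ v)
    (hNe : ∀ y, ({e, y} : Finset (EuclideanSpace ℝ (Fin 3))) ∈ B ↔ (y = q₁ ∨ y = d ∨ y = q₂ ∨ y = b))
    (hq₁ : q₁ = p₁ ∨ q₁ = p₂) (hq₂ : q₂ = p₁ ∨ q₂ = p₂)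
    (hN₁ : ∀ y, ({p₁, y} : Finset (EuclideanSpace ℝ (Fin 3))) ∈ B ↔ (y = d ∨ y = e ∨ y = x₁ ∨ y = y₁))
    (hN₂ : ∀ y, ({p₂, y} : Finset (EuclideanSpace ℝ (Fin 3))) ∈ B ↔ (y = d ∨ y = e ∨ y = x₂ ∨ y = y₂))
    (ha₁ : ({a, p₁} : Finset (EuclideanSpace ℝ (Fin 3))) ∈ B) (hc₂ : ({c, p₂} : Finset (EuclideanSpace ℝ (Fin 3))) ∈ B) : False := by
  have hva : ({v, a} : Finset (EuclideanSpace ℝ (Fin 3))) ∈ B := (hN a).2 (Or.inl rfl)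
  have hvb : ({v, b} : Finset (EuclideanSpace ℝ (Fin 3))) ∈ B := (hN b).2 (Or.inr (Or.inl rfl))
  have hvc : ({v, c} : Finset (EuclideanSpace ℝ (Fin 3))) ∈ B := (hN c).2 (Or.inr (Or.inr (Or.inl rfl)))
  have hvd : ({v, d} : Finset (EuclideanSpace ℝ (Fin 3))) ∈ B := (hN d).2 (Or.inr (Or.inr (Or.inr rfl)))
  have hbe : ({b, e} : Finset (EuclideanSpace ℝ (Fin 3))) ∈ B := (hNb e).2 (Or.inr (Or.inr (Or.inr rfl)))
  have hde : ({d, e} : Finset (EuclideanSpace ℝ (Fin 3))) ∈ B := (hNd e).2 (Or.inr (Or.inl rfl))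
  have hdp₁ : ({d, p₁} : Finset (EuclideanSpace ℝ (Fin 3))) ∈ B := (hNd p₁).2 (Or.inl rfl)
  have hdp₂ : ({d, p₂} : Finset (EuclideanSpace ℝ (Fin 3))) ∈ B := (hNd p₂).2 (Or.inr (Or.inr (Or.inl rfl)))
  have hbX : b ∈ X := (mem_of_mem_bonds hB hvb).2
  have haX : a ∈ X := (mem_of_mem_bonds hB hva).2
  have hcX : c ∈ X := (mem_of_mem_bonds hB hvc).2
  have hdX : d ∈ X := (mem_of_mem_bonds hB hvd).2
  have heX : e ∈ X := (mem_of_mem_bonds hB hbe).2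
  have hp₁X : p₁ ∈ X := (mem_of_mem_bonds hB hdp₁).2
  have hp₂X : p₂ ∈ X := (mem_of_mem_bonds hB hdp₂).2
  -- the type-O data at the wings `a`, `c` of `{v, b}`
  obtain ⟨x, y, hNa, hdxy, -, hxy, -, -, -, -, hout⟩ :=
    typeA_wing hT hX1 hcard hsepX hB hBcard hdeg hN hd hab hbc hac had hbd
  obtain ⟨hN', hd', hcb, hba, hca, hcd', hbd', had'⟩ := typeA_swap hN hd hab hbc hac had hbd hcd
  obtain ⟨x', y', hNc, hdxy', -, hxy', -, -, -, -, hout'⟩ :=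
    typeA_wing hT hX1 hcard hsepX hB hBcard hdeg hN' hd' hcb hba hca hcd' hbd'
  -- `p₁ ∈ N(a)` is `x` or `y`; `p₂ ∈ N(c)` is `x'` or `y'`
  have hp₁b : p₁ ≠ b := fun h => hbd (by rw [← h, Finset.pair_comm]; exact hdp₁)
  have hp₂b : p₂ ≠ b := fun h => hbd (by rw [← h, Finset.pair_comm]; exact hdp₂)
  have hp₁a : p₁ = x ∨ p₁ = y := by
    rcases (hNa p₁).1 ha₁ with h | h | h | h
    exacts [absurd h hp.2.2.1, absurd h hp₁b, Or.inl h, Or.inr h]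
  have hp₂c : p₂ = x' ∨ p₂ = y' := by
    rcases (hNc p₂).1 hc₂ with h | h | h | h
    exacts [absurd h hp.2.2.2.2, absurd h hp₂b, Or.inl h, Or.inr h]
  -- the other bond `y₀` of `a` and `z₀` of `c`
  obtain ⟨y₀, hy₀a, hy₀p, hNa'⟩ : ∃ y₀, ({a, y₀} : Finset (EuclideanSpace ℝ (Fin 3))) ∈ B ∧
      ({p₁, y₀} : Finset (EuclideanSpace ℝ (Fin 3))) ∈ B ∧
      ∀ z, ({a, z} : Finset (EuclideanSpace ℝ (Fin 3))) ∈ B → z = v ∨ z = b ∨ z = p₁ ∨ z = y₀ := by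
    rcases hp₁a with rfl | rfl
    · exact ⟨y, (hNa y).2 (Or.inr (Or.inr (Or.inr rfl))), hxy, fun z hz => (hNa z).1 hz⟩
    · refine ⟨x, (hNa x).2 (Or.inr (Or.inr (Or.inl rfl))), by rw [Finset.pair_comm]; exact hxy,
        fun z hz => ?_⟩
      rcases (hNa z).1 hz with h | h | h | h
      exacts [Or.inl h, Or.inr (Or.inl h), Or.inr (Or.inr (Or.inr h)), Or.inr (Or.inr (Or.inl h))]
  obtain ⟨z₀, hz₀c, hz₀p, hNc'⟩ : ∃ z₀, ({c, z₀} : Finset (EuclideanSpace ℝ (Fin 3))) ∈ B ∧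
      ({p₂, z₀} : Finset (EuclideanSpace ℝ (Fin 3))) ∈ B ∧
      ∀ z, ({c, z} : Finset (EuclideanSpace ℝ (Fin 3))) ∈ B → z = v ∨ z = b ∨ z = p₂ ∨ z = z₀ := by
    rcases hp₂c with rfl | rfl
    · exact ⟨y', (hNc y').2 (Or.inr (Or.inr (Or.inr rfl))), hxy', fun z hz => (hNc z).1 hz⟩
    · refine ⟨x', (hNc x').2 (Or.inr (Or.inr (Or.inl rfl))), by rw [Finset.pair_comm]; exact hxy',
        fun z hz => ?_⟩
      rcases (hNc z).1 hz with h | h | h | h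
      exacts [Or.inl h, Or.inr (Or.inl h), Or.inr (Or.inr (Or.inr h)), Or.inr (Or.inr (Or.inl h))]
  have hy₀X : y₀ ∈ X := (mem_of_mem_bonds hB hy₀a).2
  have hz₀X : z₀ ∈ X := (mem_of_mem_bonds hB hz₀c).2
  -- the bonds of `p₁` are `d, e, a, y₀`; of `p₂` are `d, e, c, z₀`
  have hay₀ : a ≠ y₀ := ne_of_mem_bonds hB hy₀a
  have hcz₀ : c ≠ z₀ := ne_of_mem_bonds hB hz₀c
  have hy₀d : y₀ ≠ d := fun h => had (h ▸ hy₀a)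
  have hy₀e : y₀ ≠ e := fun h => hae (h ▸ hy₀a)
  have hz₀d : z₀ ≠ d := fun h => hcd (h ▸ hz₀c)
  have hz₀e : z₀ ≠ e := fun h => hce (h ▸ hz₀c)
  have had' : a ≠ d := hd.2.2.1
  have hcd'' : c ≠ d := hd.2.2.2.2.2
  have hNp₁ : ∀ z, ({p₁, z} : Finset (EuclideanSpace ℝ (Fin 3))) ∈ B → z = d ∨ z = e ∨ z = a ∨ z = y₀ := by
    have ha' : a = x₁ ∨ a = y₁ := by
      rcases (hN₁ a).1 (by rw [Finset.pair_comm]; exact ha₁) with h | h | h | h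
      exacts [absurd h had', absurd h he.2.1.symm, Or.inl h, Or.inr h]
    have hy' : y₀ = x₁ ∨ y₀ = y₁ := by
      rcases (hN₁ y₀).1 hy₀p with h | h | h | h
      exacts [absurd h hy₀d, absurd h hy₀e, Or.inl h, Or.inr h]
    intro z hz
    rcases (hN₁ z).1 hz with h | h | h | h
    · exact Or.inl h
    · exact Or.inr (Or.inl h)
    · rcases ha' with e1 | e1
      · exact Or.inr (Or.inr (Or.inl (h.trans e1.symm)))
      · rcases hy' with e2 | e2
        · exact Or.inr (Or.inr (Or.inr (h.trans e2.symm)))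
        · exact absurd (e1.trans e2.symm) hay₀
    · rcases ha' with e1 | e1
      · rcases hy' with e2 | e2
        · exact absurd (e1.trans e2.symm) hay₀
        · exact Or.inr (Or.inr (Or.inr (h.trans e2.symm)))
      · exact Or.inr (Or.inr (Or.inl (h.trans e1.symm)))
  have hNp₂ : ∀ z, ({p₂, z} : Finset (EuclideanSpace ℝ (Fin 3))) ∈ B → z = d ∨ z = e ∨ z = c ∨ z = z₀ := by
    have hc' : c = x₂ ∨ c = y₂ := by
      rcases (hN₂ c).1 (by rw [Finset.pair_comm]; exact hc₂) with h | h | h | h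
      exacts [absurd h hcd'', absurd h he.2.2.2.1.symm, Or.inl h, Or.inr h]
    have hz' : z₀ = x₂ ∨ z₀ = y₂ := by
      rcases (hN₂ z₀).1 hz₀p with h | h | h | h
      exacts [absurd h hz₀d, absurd h hz₀e, Or.inl h, Or.inr h]
    intro z hz
    rcases (hN₂ z).1 hz with h | h | h | h
    · exact Or.inl h
    · exact Or.inr (Or.inl h)
    · rcases hc' with e1 | e1
      · exact Or.inr (Or.inr (Or.inl (h.trans e1.symm)))
      · rcases hz' with e2 | e2
        · exact Or.inr (Or.inr (Or.inr (h.trans e2.symm)))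
        · exact absurd (e1.trans e2.symm) hcz₀
    · rcases hc' with e1 | e1
      · rcases hz' with e2 | e2
        · exact absurd (e1.trans e2.symm) hcz₀
        · exact Or.inr (Or.inr (Or.inr (h.trans e2.symm)))
      · exact Or.inr (Or.inr (Or.inl (h.trans e1.symm)))
  -- the saturated eight points and the ten-point set
  have hav : a ≠ v := hdxy.2.1.symm |> fun _ => (ne_of_mem_bonds hB hva).symm
  have hbv : b ≠ v := (ne_of_mem_bonds hB hvb).symm
  have hcv : c ≠ v := (ne_of_mem_bonds hB hvc).symm
  have hdv : d ≠ v := (ne_of_mem_bonds hB hvd).symm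
  have hp₁a' : p₁ ≠ a := (ne_of_mem_bonds hB ha₁).symm
  have hp₂c' : p₂ ≠ c := (ne_of_mem_bonds hB hc₂).symm
  have hp₁c : p₁ ≠ c := fun h => hac (h ▸ ha₁)
  have hp₂a : p₂ ≠ a := fun h => hac (by rw [Finset.pair_comm]; exact h ▸ hc₂)
  have hp₁d : p₁ ≠ d := (ne_of_mem_bonds hB hdp₁).symm
  have hp₂d : p₂ ≠ d := (ne_of_mem_bonds hB hdp₂).symm
  set S : Finset (EuclideanSpace ℝ (Fin 3)) := {v, b, d, e, a, c, p₁, p₂} with hS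
  set T : Finset (EuclideanSpace ℝ (Fin 3)) := insert y₀ (insert z₀ S) with hT'
  have hSX : S ⊆ X := by
    intro u hu
    simp only [hS, Finset.mem_insert, Finset.mem_singleton] at hu
    rcases hu with rfl | rfl | rfl | rfl | rfl | rfl | rfl | rfl
    exacts [hv, hbX, hdX, heX, haX, hcX, hp₁X, hp₂X]
  have hTX : T ⊆ X := by
    intro u hu
    rw [hT', Finset.mem_insert, Finset.mem_insert] at hu
    rcases hu with rfl | rfl | hu
    exacts [hy₀X, hz₀X, hSX hu]
  have hST : S ⊆ T := fun u hu => by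
    rw [hT']; exact Finset.mem_insert_of_mem (Finset.mem_insert_of_mem hu)
  have hS8 : S.card = 8 := by
    rw [hS, Finset.card_insert_of_notMem, Finset.card_insert_of_notMem,
      Finset.card_insert_of_notMem, Finset.card_insert_of_notMem, Finset.card_insert_of_notMem,
      Finset.card_insert_of_notMem, Finset.card_pair hp.2.1]
    all_goals simp only [Finset.mem_insert, Finset.mem_singleton, not_or]
    · exact ⟨hp₁c.symm, hp₂c'.symm⟩
    · exact ⟨hd.2.1, hp₁a'.symm, hp₂a.symm⟩
    · exact ⟨he.2.1, he.2.2.2.1, hp.1.symm, hp.2.2.2.1⟩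
    · exact ⟨he.2.2.2.2.symm, had'.symm, hcd''.symm, hp₁d.symm, hp₂d.symm⟩
    · exact ⟨hd.2.2.2.1.symm |> fun _ => (hd.2.2.2.2.1), he.2.2.1.symm, hd.1.symm, hd.2.2.2.1,
        hp₁b.symm, hp₂b.symm⟩
    · exact ⟨hbv.symm, hdv.symm, he.1.symm, hav.symm, hcv.symm, hp.2.2.1.symm, hp.2.2.2.2.symm⟩
  have hT10 : T.card ≤ 10 := by
    rw [hT']
    refine (Finset.card_insert_le _ _).trans ?_
    have := Finset.card_insert_le z₀ S
    omega
  refine saturated_eight_false hcard hdeg hSX hS8 hST hTX hT10 ?_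
  -- saturation
  have memS : ∀ {u : EuclideanSpace ℝ (Fin 3)}, u = v ∨ u = b ∨ u = d ∨ u = e ∨ u = a ∨ u = c ∨ u = p₁ ∨ u = p₂ → u ∈ T := by
    intro u hu
    apply hST
    simp only [hS, Finset.mem_insert, Finset.mem_singleton]
    exact hu
  have memy₀ : y₀ ∈ T := by rw [hT']; exact Finset.mem_insert_self _ _
  have memz₀ : z₀ ∈ T := by
    rw [hT']; exact Finset.mem_insert_of_mem (Finset.mem_insert_self _ _)
  intro s hs z hz
  simp only [hS, Finset.mem_insert, Finset.mem_singleton] at hs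
  rcases hs with rfl | rfl | rfl | rfl | rfl | rfl | rfl | rfl
  · rcases (hN z).1 hz with h | h | h | h <;> apply memS <;> simp [h]
  · rcases (hNb z).1 hz with h | h | h | h <;> apply memS <;> simp [h]
  · rcases (hNd z).1 hz with h | h | h | h <;> apply memS <;> simp [h]
  · rcases (hNe z).1 hz with h | h | h | h
    · rcases hq₁ with e1 | e1 <;> apply memS <;> simp [h, e1]
    · apply memS; simp [h]
    · rcases hq₂ with e1 | e1 <;> apply memS <;> simp [h, e1]
    · apply memS; simp [h]
  · rcases hNa' z hz with h | h | h | h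
    · apply memS; simp [h]
    · apply memS; simp [h]
    · apply memS; simp [h]
    · rw [h]; exact memy₀
  · rcases hNc' z hz with h | h | h | h
    · apply memS; simp [h]
    · apply memS; simp [h]
    · apply memS; simp [h]
    · rw [h]; exact memz₀
  · rcases hNp₁ z hz with h | h | h | h
    · apply memS; simp [h]
    · apply memS; simp [h]
    · apply memS; simp [h]
    · rw [h]; exact memy₀
  · rcases hNp₂ z hz with h | h | h | h
    · apply memS; simp [h]
    · apply memS; simp [h]
    · apply memS; simp [h]
    · rw [h]; exact memz₀

open scoped Classical in
/-- **No alternating 4-cycle**: with type-A data `(a, b, c, d)` at `v`, `(a, v, c, e)` at the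
`α`-partner `b` and `(a₃, b₃, c₃, v)` at the `γ`-partner `d`, we have `e ≠ b₃`. -/
theorem alternating_four_cycle_false
    {X : Finset (EuclideanSpace ℝ (Fin 3))}
    {B : Finset (Finset (EuclideanSpace ℝ (Fin 3)))}
    (hT : ∀ p : EuclideanSpace ℝ (Fin 3), ‖p‖ = 1 → ∃ x ∈ X, dist p x < 0.957)
    (hX1 : ∀ y ∈ X, ‖y‖ = 1)
    (hcard : X.card = 12)
    (hsepX : ∀ u ∈ X, ∀ u' ∈ X, u ≠ u' → ⟪u, u'⟫ ≤ 1 - 1 / (2 * (101 / 100 : ℝ) ^ 2))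
    (hB : ∀ T ∈ B, ∃ u ∈ X, ∃ u' ∈ X, u ≠ u' ∧ 1 - (101 / 100 : ℝ) ^ 2 / 2 ≤ ⟪u, u'⟫ ∧ T = {u, u'})
    (hBcard : B.card = 24)
    (hdeg : ∀ v ∈ X, ∃ w : Fin 4 → EuclideanSpace ℝ (Fin 3), (∀ k, w k ∈ X) ∧ Function.Injective w ∧ (∀ k, w k ≠ v) ∧ (∀ k, ({v, w k} : Finset (EuclideanSpace ℝ (Fin 3))) ∈ B) ∧ ∀ y, ({v, y} : Finset (EuclideanSpace ℝ (Fin 3))) ∈ B → ∃ k, y = w k) {v a b c d e a₃ b₃ c₃ : EuclideanSpace ℝ (Fin 3)} (hv : v ∈ X)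
    (hN : ∀ y, ({v, y} : Finset (EuclideanSpace ℝ (Fin 3))) ∈ B ↔ (y = a ∨ y = b ∨ y = c ∨ y = d))
    (hd : a ≠ b ∧ a ≠ c ∧ a ≠ d ∧ b ≠ c ∧ b ≠ d ∧ c ≠ d)
    (hab : ({a, b} : Finset (EuclideanSpace ℝ (Fin 3))) ∈ B) (hbc : ({b, c} : Finset (EuclideanSpace ℝ (Fin 3))) ∈ B)
    (hac : ({a, c} : Finset (EuclideanSpace ℝ (Fin 3))) ∉ B) (had : ({a, d} : Finset (EuclideanSpace ℝ (Fin 3))) ∉ B)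
    (hbd : ({b, d} : Finset (EuclideanSpace ℝ (Fin 3))) ∉ B) (hcd : ({c, d} : Finset (EuclideanSpace ℝ (Fin 3))) ∉ B)
    (he : e ≠ v ∧ e ≠ a ∧ e ≠ b ∧ e ≠ c ∧ e ≠ d)
    (hNb : ∀ y, ({b, y} : Finset (EuclideanSpace ℝ (Fin 3))) ∈ B ↔ (y = a ∨ y = v ∨ y = c ∨ y = e))
    (hae : ({a, e} : Finset (EuclideanSpace ℝ (Fin 3))) ∉ B) (hve : ({v, e} : Finset (EuclideanSpace ℝ (Fin 3))) ∉ B)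
    (hce : ({c, e} : Finset (EuclideanSpace ℝ (Fin 3))) ∉ B)
    (hN₃ : ∀ y, ({d, y} : Finset (EuclideanSpace ℝ (Fin 3))) ∈ B ↔ (y = a₃ ∨ y = b₃ ∨ y = c₃ ∨ y = v))
    (hd₃ : a₃ ≠ b₃ ∧ a₃ ≠ c₃ ∧ a₃ ≠ v ∧ b₃ ≠ c₃ ∧ b₃ ≠ v ∧ c₃ ≠ v)
    (hab₃ : ({a₃, b₃} : Finset (EuclideanSpace ℝ (Fin 3))) ∈ B) (hbc₃ : ({b₃, c₃} : Finset (EuclideanSpace ℝ (Fin 3))) ∈ B)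
    (hac₃ : ({a₃, c₃} : Finset (EuclideanSpace ℝ (Fin 3))) ∉ B) (hav₃ : ({a₃, v} : Finset (EuclideanSpace ℝ (Fin 3))) ∉ B)
    (hbv₃ : ({b₃, v} : Finset (EuclideanSpace ℝ (Fin 3))) ∉ B) (hcv₃ : ({c₃, v} : Finset (EuclideanSpace ℝ (Fin 3))) ∉ B)
    (heb : e = b₃) : False := by
  subst heb
  have hde : ({d, e} : Finset (EuclideanSpace ℝ (Fin 3))) ∈ B := (hN₃ e).2 (Or.inr (Or.inl rfl))
  have hed : ({e, d} : Finset (EuclideanSpace ℝ (Fin 3))) ∈ B := by rw [Finset.pair_comm]; exact hde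
  -- data at `e` (with `γ`-partner `b`), at the wings `a₃, c₃` of `d`, at the `α`-partner of `e`
  obtain ⟨a₄, b₄, c₄, hN₄, hd₄, hab₄, hbc₄, hac₄, -, hbb₄, -⟩ :=
    typeA_gamma hT hX1 hcard hsepX hB hBcard hdeg hNb hae hve hce
  obtain ⟨hN₃', hd₃', hcb₃, hba₃, hca₃, hcv₃', hbv₃', hav₃'⟩ :=
    typeA_swap hN₃ hd₃ hab₃ hbc₃ hac₃ hav₃ hbv₃ hcv₃
  obtain ⟨x₁, y₁, hNa₃, hda₃, -, -, hn1, hn2, hn3, hn4, -⟩ :=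
    typeA_wing hT hX1 hcard hsepX hB hBcard hdeg hN₃ hd₃ hab₃ hbc₃ hac₃ hav₃ hbv₃
  obtain ⟨x₂, y₂, hNc₃, hdc₃, -, -, hm1, hm2, hm3, hm4, -⟩ :=
    typeA_wing hT hX1 hcard hsepX hB hBcard hdeg hN₃' hd₃' hcb₃ hba₃ hca₃ hcv₃' hbv₃'
  obtain ⟨g, -, -, -, -, -, hNb₄, hdb₄, hB4a, hB4b, -, -, -, -⟩ :=
    typeA_partner hT hX1 hcard hsepX hB hBcard hdeg hN₄ hd₄ hab₄ hbc₄ hac₄ hbb₄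
  -- `d = b₄`: a wing `a₄` or `c₄` equal to `d` would make `b₄` a type-O wing of `d`
  have key : ∀ m, ({d, m} : Finset (EuclideanSpace ℝ (Fin 3))) ∈ B → ({e, m} : Finset (EuclideanSpace ℝ (Fin 3))) ∈ B →
      (∀ y, ({m, y} : Finset (EuclideanSpace ℝ (Fin 3))) ∈ B ↔ (y = a₄ ∨ y = e ∨ y = c₄ ∨ y = g)) →
      (a₄ ≠ e ∧ a₄ ≠ c₄ ∧ a₄ ≠ g ∧ e ≠ c₄ ∧ e ≠ g ∧ c₄ ≠ g) →
      ({a₄, e} : Finset (EuclideanSpace ℝ (Fin 3))) ∈ B → ({e, c₄} : Finset (EuclideanSpace ℝ (Fin 3))) ∈ B → False := by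
    intro m hdm hem hNm hdm' hB1 hB2
    rcases (hN₃ m).1 hdm with rfl | rfl | rfl | rfl
    · exact typeO_typeA_false hNa₃ hda₃ hn1 hn2 hn3 hn4 hNm hdm' hB1 hB2
    · exact (ne_of_mem_bonds hB hem) rfl
    · exact typeO_typeA_false hNc₃ hdc₃ hm1 hm2 hm3 hm4 hNm hdm' hB1 hB2
    · exact hve (by rw [Finset.pair_comm]; exact hem)
  have heb₄ : ({e, b₄} : Finset (EuclideanSpace ℝ (Fin 3))) ∈ B := (hN₄ b₄).2 (Or.inr (Or.inl rfl))
  have hdb₄' : d = b₄ := by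
    rcases (hN₄ d).1 hed with h | h | h | h
    · exact (key b₄ (by rw [h]; exact hab₄) heb₄ hNb₄ hdb₄ hB4a hB4b).elim
    · exact h
    · exact (key b₄ (by rw [h, Finset.pair_comm]; exact hbc₄) heb₄ hNb₄ hdb₄ hB4a hB4b).elim
    · exact absurd h hd.2.2.2.2.1.symm
  subst hdb₄'
  -- the wings of `{d, e}` are `a₃, c₃`
  have hq : ∀ z, ({z, d} : Finset (EuclideanSpace ℝ (Fin 3))) ∈ B → ({z, e} : Finset (EuclideanSpace ℝ (Fin 3))) ∈ B → z = a₃ ∨ z = c₃ :=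
    fun z h1 h2 => common_of_alpha hB hN₃ hbv₃ h1 h2
  have hq₁ : a₄ = a₃ ∨ a₄ = c₃ :=
    hq a₄ hab₄ (by rw [Finset.pair_comm]; exact (hN₄ a₄).2 (Or.inl rfl))
  have hq₂ : c₄ = a₃ ∨ c₄ = c₃ :=
    hq c₄ (by rw [Finset.pair_comm]; exact hbc₄)
      (by rw [Finset.pair_comm]; exact (hN₄ c₄).2 (Or.inr (Or.inr (Or.inl rfl))))
  -- the cells at `v` end at the wings of `d`
  rcases cells_end_at_wings hT hX1 hcard hsepX hB hBcard hdeg hv hN hd hab hbc hac had hbd hcd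
      hN₃ hd₃ hab₃ hbc₃ hac₃ hav₃ hbv₃ hcv₃ with ⟨ha, hc⟩ | ⟨ha, hc⟩
  · exact four_cycle_core hT hX1 hcard hsepX hB hBcard hdeg hv hN hd hab hbc hac had hbd hcd he hNb
      hae hce hN₃ ⟨hd₃.1, hd₃.2.1, hd₃.2.2.1, hd₃.2.2.2.1, hd₃.2.2.2.2.2⟩ hN₄ hq₁ hq₂ hNa₃ hNc₃ ha hc
  · have hq₁' : a₄ = c₃ ∨ a₄ = a₃ := hq₁.symm
    have hq₂' : c₄ = c₃ ∨ c₄ = a₃ := hq₂.symm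
    exact four_cycle_core hT hX1 hcard hsepX hB hBcard hdeg hv hN hd hab hbc hac had hbd hcd he hNb
      hae hce hN₃' ⟨hd₃.2.2.2.1.symm, hd₃.2.1.symm, hd₃.2.2.2.2.2, hd₃.1.symm, hd₃.2.2.1⟩ hN₄ hq₁' hq₂'
      hNc₃ hNa₃ ha hc

end Setting

end Summit.AtomisticToContinuum.Crystallization.Theorems.Cap
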